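import Mathlib.Analysis.Calculus.ParametricIntegral
import Mathlib.Analysis.Calculus.ContDiff.FiniteDimension
import Literature.MathematicalPhysics.QuantumManyBody.PeriodicTorusByParts
import Literature.MathematicalPhysics.QuantumManyBody.PeriodicCellChangeOfVariables
import Literature.MathematicalPhysics.QuantumManyBody.PeriodicBoseGasEq317Bdd

/-!
# Route BECSubharmonicContinuation · support `HarmonicMinorant` (stmt-AtomisticToContinuum-9003), I:
# calculus of correlation integrals on the torus

Helper file (supports the item; the closing theorem is in
`BECSubharmonicContinuationHarmonicMinorant.lean`). For `C¹`/`C⁰` functions `a, b` on the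
configuration space `(ℝ³)^N` and a particle slot `i`, the **correlation integral**
`P(y) = ∫_{[0,L)^{3N}} conj(a(X + y e_i)) b(X) dX` (`y ∈ ℝ³`; for `a = b = Ψ` this is the
translation-averaged one-body density matrix of the route) satisfies:

* `hasFDerivAt_corr`, `fderiv_corr_apply` — differentiation under the integral sign
  (`hasFDerivAt_integral_of_dominated_of_fderiv_le`; the cell is bounded, the integrand `C¹`);
* `continuous_corr` — continuity (dominated convergence);
* `corr_fderiv_left_eq_neg` — `∫ conj(∂_w a(X + y e_i)) b = -∫ conj(a(X + y e_i)) ∂_w b` for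
  periodic `a, b` (periodic integration by parts, `integral_cellN_mul_fderiv_apply`).

(`Function.update X i (X i + y) = X + Pi.single i y` is the tree's
`Literature.MathematicalPhysics.QuantumManyBody.BoseGas.update_eq_add_single`.)

No definitions and no notation (the slot embedding `y ↦ y e_i` is Mathlib's
`ContinuousLinearMap.single ℝ (fun _ => Space) i`). Elaboration note: `X + Pi.single i y` is always
written with the ascription `(Pi.single i y : Config N)`.

## References

* D. Gilbarg, N. S. Trudinger, *Elliptic Partial Differential Equations of Second Order*
  (Springer 2001), Thm 2.1 (mean value), (2.10)–(2.17) (Green's identities and representation)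
  [GilbargTrudinger2001].
* E. H. Lieb, R. Seiringer, J. P. Solovej, J. Yngvason, *The Mathematics of the Bose Gas and its
  Condensation* (2005), §1.2 (1.17)–(1.19) (one-body density matrix) [LiebSeiringerSolovejYngvason2005].
-/

noncomputable section

open MeasureTheory Filter Metric Set Function Real InnerProductSpace
open scoped ComplexConjugate Topology RealInnerProductSpace Laplacian

namespace Summit.AtomisticToContinuum.BoseEinsteinCondensation.Theorems

namespace HarmonicMinorant

open Literature.MathematicalPhysics.QuantumManyBody.BoseGas

variable {N : ℕ} {L : ℝ}

/-- `y ↦ X + y e_i` has derivative the slot embedding. [folklore] -/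
theorem hasFDerivAt_add_single (X : Config N) (i : Fin N) (y : Space) :
    HasFDerivAt (fun y : Space => X + (Pi.single i y : Config N)) (ContinuousLinearMap.single ℝ (fun _ : Fin N => Space) i : Space →L[ℝ] Config N) y :=
  ((ContinuousLinearMap.single ℝ (fun _ : Fin N => Space) i).hasFDerivAt).const_add X

/-- The sup norm of `y e_i ∈ (Space)^N` is `‖y‖`. [folklore] -/
theorem norm_single_config (i : Fin N) (y : Space) : ‖(Pi.single i y : Config N)‖ = ‖y‖ := by
  rw [Pi.norm_single]

/-- Points `X + y e_i` with `X` in the cell and `‖y‖ ≤ ρ` lie in the closed ball of radius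
`2|L| + ρ`. [folklore] -/
theorem norm_add_single_le {X : Config N} (hX : X ∈ cellN N L) (i : Fin N) {y : Space} {ρ : ℝ}
    (hy : ‖y‖ ≤ ρ) : ‖X + (Pi.single i y : Config N)‖ ≤ 2 * |L| + ρ := by
  calc ‖X + (Pi.single i y : Config N)‖ ≤ ‖X‖ + ‖(Pi.single i y : Config N)‖ := norm_add_le _ _
    _ ≤ 2 * |L| + ρ := by
        rw [norm_single_config]
        exact add_le_add (norm_le_two_mul_abs_of_mem_cellN hX) hy

/-- Evaluation of the derivative integrand. [folklore] -/
theorem smul_conj_comp_slot_apply (i : Fin N) (c : ℂ) (T : Config N →L[ℝ] ℂ) (v : Space) :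
    (c • ((Complex.conjCLE : ℂ →L[ℝ] ℂ).comp (T.comp (ContinuousLinearMap.single ℝ (fun _ : Fin N => Space) i : Space →L[ℝ] Config N)))) v =
      c * conj (T (Pi.single i v : Config N)) := rfl

/-- **Differentiation under the integral sign for the correlation integral**
`P(y) = ∫_{cell} conj(a(X + y e_i)) b(X) dX`, `a ∈ C¹`, `b ∈ C⁰`:
`DP(y) v = ∫ conj(Da(X + y e_i)(v e_i)) b(X) dX`. [folklore] -/
theorem hasFDerivAt_corr (i : Fin N) {a b : Config N → ℂ} (ha : ContDiff ℝ 1 a)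
    (hb : Continuous b) (y₀ : Space) :
    HasFDerivAt (fun y : Space => ∫ X in cellN N L, conj (a (X + (Pi.single i y : Config N))) * b X)
      (∫ X in cellN N L, b X • ((Complex.conjCLE : ℂ →L[ℝ] ℂ).comp
        ((fderiv ℝ a (X + (Pi.single i y₀ : Config N))).comp (ContinuousLinearMap.single ℝ (fun _ : Fin N => Space) i : Space →L[ℝ] Config N)))) y₀ := by
  have had : Differentiable ℝ a := ha.differentiable one_ne_zero
  have hDa : Continuous (fderiv ℝ a) := ha.continuous_fderiv one_ne_zero
  -- uniform bounds on the relevant compact sets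
  obtain ⟨Ca, hCa⟩ := (isCompact_closedBall (0 : Config N)
    (2 * |L| + (‖y₀‖ + 1))).exists_bound_of_continuousOn hDa.continuousOn
  obtain ⟨Cb, hCb⟩ := (isCompact_closedBall (0 : Config N) (2 * |L|)).exists_bound_of_continuousOn
    hb.continuousOn
  have hCa0 : 0 ≤ Ca := (norm_nonneg _).trans (hCa 0 (mem_closedBall_self (by positivity)))
  have hCb0 : 0 ≤ Cb := (norm_nonneg _).trans (hCb 0 (mem_closedBall_self (by positivity)))
  -- the derivative of the integrand
  set F' : Space → Config N → (Space →L[ℝ] ℂ) := fun y X => b X •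
    ((Complex.conjCLE : ℂ →L[ℝ] ℂ).comp ((fderiv ℝ a (X + (Pi.single i y : Config N))).comp (ContinuousLinearMap.single ℝ (fun _ : Fin N => Space) i : Space →L[ℝ] Config N)))
    with hF'def
  have hF'apply : ∀ y X v, F' y X v =
      b X * conj (fderiv ℝ a (X + (Pi.single i y : Config N)) (Pi.single i v : Config N)) := fun y X v => rfl
  have hF'norm : ∀ X ∈ cellN N L, ∀ y ∈ ball y₀ 1, ‖F' y X‖ ≤ Cb * Ca := by
    intro X hX y hy
    have h1 : ‖b X‖ ≤ Cb := hCb X (mem_closedBall_zero_iff.2 (norm_le_two_mul_abs_of_mem_cellN hX))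
    have h2 : ‖fderiv ℝ a (X + (Pi.single i y : Config N))‖ ≤ Ca := hCa _ (mem_closedBall_zero_iff.2
      (norm_add_single_le hX i (by
        have := mem_ball_iff_norm.1 hy
        linarith [norm_sub_norm_le y y₀])))
    refine ContinuousLinearMap.opNorm_le_bound _ (mul_nonneg hCb0 hCa0) fun v => ?_
    rw [hF'apply, norm_mul, Complex.norm_conj]
    have h3 : ‖fderiv ℝ a (X + (Pi.single i y : Config N)) (Pi.single i v : Config N)‖ ≤ Ca * ‖v‖ := by
      calc ‖fderiv ℝ a (X + (Pi.single i y : Config N)) (Pi.single i v : Config N)‖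
          ≤ ‖fderiv ℝ a (X + (Pi.single i y : Config N))‖ * ‖(Pi.single i v : Config N)‖ :=
            ContinuousLinearMap.le_opNorm _ _
        _ ≤ Ca * ‖v‖ := by
            rw [norm_single_config]
            exact mul_le_mul_of_nonneg_right h2 (norm_nonneg _)
    calc ‖b X‖ * ‖fderiv ℝ a (X + (Pi.single i y : Config N)) (Pi.single i v : Config N)‖
        ≤ Cb * (Ca * ‖v‖) := mul_le_mul h1 h3 (norm_nonneg _) hCb0
      _ = Cb * Ca * ‖v‖ := by ring
  have hF'deriv : ∀ X y, HasFDerivAt (fun y : Space => conj (a (X + (Pi.single i y : Config N))) * b X)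
      (F' y X) y := by
    intro X y
    have h1 : HasFDerivAt (fun y : Space => a (X + (Pi.single i y : Config N)))
        ((fderiv ℝ a (X + (Pi.single i y : Config N))).comp (ContinuousLinearMap.single ℝ (fun _ : Fin N => Space) i : Space →L[ℝ] Config N)) y :=
      (had _).hasFDerivAt.comp y (hasFDerivAt_add_single X i y)
    have h2 : HasFDerivAt (fun y : Space => conj (a (X + (Pi.single i y : Config N))))
        ((Complex.conjCLE : ℂ →L[ℝ] ℂ).comp ((fderiv ℝ a (X + (Pi.single i y : Config N))).comp (ContinuousLinearMap.single ℝ (fun _ : Fin N => Space) i : Space →L[ℝ] Config N))) y :=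
      Complex.conjCLE.hasFDerivAt.comp y h1
    exact h2.mul_const (b X)
  have htr : ∀ y : Space, Continuous fun X : Config N => X + Pi.single i y := fun y =>
    continuous_id.add continuous_const
  have hF'cont : Continuous (F' y₀) :=
    Continuous.smul hb
      (continuous_const.clm_comp ((hDa.comp (htr y₀)).clm_comp continuous_const))
  have hFc : ∀ y, Continuous fun X => conj (a (X + (Pi.single i y : Config N))) * b X := fun y =>
    (Complex.continuous_conj.comp (ha.continuous.comp (htr y))).mul hb
  have hmeas : ∀ y, AEStronglyMeasurable (fun X => conj (a (X + (Pi.single i y : Config N))) * b X)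
      (volume.restrict (cellN N L)) := fun y => (hFc y).aestronglyMeasurable
  have hint : Integrable (fun X => conj (a (X + (Pi.single i y₀ : Config N))) * b X)
      (volume.restrict (cellN N L)) := integrableOn_cellN (hFc y₀) L
  have hbd : ∀ᵐ X ∂(volume.restrict (cellN N L)), ∀ y ∈ ball y₀ 1, ‖F' y X‖ ≤ Cb * Ca := by
    filter_upwards [ae_restrict_mem (measurableSet_cellN N L)] with X hX using hF'norm X hX
  have hbi : Integrable (fun _ : Config N => Cb * Ca) (volume.restrict (cellN N L)) :=
    integrableOn_const (by rw [volume_cellN]; exact ENNReal.pow_ne_top (ENNReal.pow_ne_top ENNReal.ofReal_ne_top))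
  have key := hasFDerivAt_integral_of_dominated_of_fderiv_le (𝕜 := ℝ) (ball_mem_nhds y₀ one_pos)
    (Eventually.of_forall hmeas) hint hF'cont.aestronglyMeasurable hbd hbi
    (Eventually.of_forall fun X y _ => hF'deriv X y)
  exact key

/-- Integrability on the cell of the derivative integrand (it is continuous). [folklore] -/
theorem integrable_corr_deriv (i : Fin N) {a b : Config N → ℂ} (ha : ContDiff ℝ 1 a)
    (hb : Continuous b) (y₀ : Space) :
    Integrable (fun X => b X • ((Complex.conjCLE : ℂ →L[ℝ] ℂ).comp
        ((fderiv ℝ a (X + (Pi.single i y₀ : Config N))).comp (ContinuousLinearMap.single ℝ (fun _ : Fin N => Space) i : Space →L[ℝ] Config N))))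
      (volume.restrict (cellN N L)) := by
  have hDa : Continuous (fderiv ℝ a) := ha.continuous_fderiv one_ne_zero
  have htr : Continuous fun X : Config N => X + (Pi.single i y₀ : Config N) :=
    continuous_id.add continuous_const
  exact integrableOn_cellN (Continuous.smul hb
    (continuous_const.clm_comp ((hDa.comp htr).clm_comp continuous_const))) L

/-- **The directional derivative of the correlation integral**:
`∂_v ∫ conj(a(X + y e_i)) b(X) dX = ∫ conj(Da(X + y e_i)(v e_i)) b(X) dX`. [folklore] -/
theorem fderiv_corr_apply (i : Fin N) {a b : Config N → ℂ} (ha : ContDiff ℝ 1 a)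
    (hb : Continuous b) (y : Space) (v : Space) :
    fderiv ℝ (fun y : Space => ∫ X in cellN N L, conj (a (X + (Pi.single i y : Config N))) * b X) y v
      = ∫ X in cellN N L,
          conj (fderiv ℝ a (X + (Pi.single i y : Config N)) (Pi.single i v : Config N)) * b X := by
  rw [(hasFDerivAt_corr i ha hb y).fderiv, ContinuousLinearMap.integral_apply
    (integrable_corr_deriv i ha hb y)]
  refine integral_congr_ae (Eventually.of_forall fun X => ?_)
  show (b X • ((Complex.conjCLE : ℂ →L[ℝ] ℂ).comp
        ((fderiv ℝ a (X + (Pi.single i y : Config N))).comp (ContinuousLinearMap.single ℝ (fun _ : Fin N => Space) i : Space →L[ℝ] Config N)))) v = _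
  rw [smul_conj_comp_slot_apply, mul_comm]

/-- The correlation integral is differentiable. [folklore] -/
theorem differentiable_corr (i : Fin N) {a b : Config N → ℂ} (ha : ContDiff ℝ 1 a)
    (hb : Continuous b) :
    Differentiable ℝ (fun y : Space => ∫ X in cellN N L,
      conj (a (X + (Pi.single i y : Config N))) * b X) :=
  fun y => (hasFDerivAt_corr i ha hb y).differentiableAt

/-- **Continuity of the correlation integral** `y ↦ ∫_{cell} conj(c(X + y e_i)) d(X) dX` for
continuous `c, d` (dominated convergence on the bounded cell). [folklore] -/
theorem continuous_corr (i : Fin N) {c d : Config N → ℂ} (hc : Continuous c) (hd : Continuous d) :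
    Continuous (fun y : Space => ∫ X in cellN N L, conj (c (X + (Pi.single i y : Config N))) * d X) := by
  refine continuous_iff_continuousAt.2 fun y₀ => ?_
  obtain ⟨Cc, hCc⟩ := (isCompact_closedBall (0 : Config N)
    (2 * |L| + (‖y₀‖ + 1))).exists_bound_of_continuousOn hc.continuousOn
  obtain ⟨Cd, hCd⟩ := (isCompact_closedBall (0 : Config N) (2 * |L|)).exists_bound_of_continuousOn
    hd.continuousOn
  have hCc0 : 0 ≤ Cc := (norm_nonneg _).trans (hCc 0 (mem_closedBall_self (by positivity)))
  have htr : ∀ y : Space, Continuous fun X : Config N => X + (Pi.single i y : Config N) := fun y =>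
    continuous_id.add continuous_const
  have hFc : ∀ y, Continuous fun X => conj (c (X + (Pi.single i y : Config N))) * d X := fun y =>
    (Complex.continuous_conj.comp (hc.comp (htr y))).mul hd
  have hbound : ∀ X ∈ cellN N L, ∀ y ∈ ball y₀ 1,
      ‖conj (c (X + (Pi.single i y : Config N))) * d X‖ ≤ Cc * Cd := by
    intro X hX y hy
    rw [norm_mul, Complex.norm_conj]
    refine mul_le_mul (hCc _ (mem_closedBall_zero_iff.2 (norm_add_single_le hX i ?_)))
      (hCd X (mem_closedBall_zero_iff.2 (norm_le_two_mul_abs_of_mem_cellN hX))) (norm_nonneg _) hCc0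
    have := mem_ball_iff_norm.1 hy
    linarith [norm_sub_norm_le y y₀]
  refine continuousAt_of_dominated (bound := fun _ => Cc * Cd) ?_ ?_ ?_ ?_
  · exact Eventually.of_forall fun y => (hFc y).aestronglyMeasurable
  · filter_upwards [ball_mem_nhds y₀ (one_pos : (0 : ℝ) < 1)] with y hy
    filter_upwards [ae_restrict_mem (measurableSet_cellN N L)] with X hX using hbound X hX y hy
  · exact integrableOn_const (by rw [volume_cellN]; exact ENNReal.pow_ne_top (ENNReal.pow_ne_top ENNReal.ofReal_ne_top))
  · refine Eventually.of_forall fun X => ?_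
    have h1 : Continuous fun y : Space => X + (Pi.single i y : Config N) :=
      continuous_const.add (ContinuousLinearMap.single ℝ (fun _ : Fin N => Space) i).continuous
    exact ((Complex.continuous_conj.comp (hc.comp h1)).mul continuous_const).continuousAt

/-- **Moving the derivative across the correlation integral** (periodic integration by parts on
the torus): for `C¹` functions `a, b` that are `Lℤ³`-periodic in every particle,
`∫ conj(Da(X + y e_i) w) b(X) dX = -∫ conj(a(X + y e_i)) Db(X) w dX`. [folklore] -/
theorem corr_fderiv_left_eq_neg (hL : 0 < L) (i : Fin N) {a b : Config N → ℂ}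
    (ha : ContDiff ℝ 1 a) (hb : ContDiff ℝ 1 b)
    (haper : ∀ (X : Config N) (j : Fin N) (c : Fin 3),
      a (X + Pi.single j (EuclideanSpace.single c L)) = a X)
    (hbper : ∀ (X : Config N) (j : Fin N) (c : Fin 3),
      b (X + Pi.single j (EuclideanSpace.single c L)) = b X)
    (y : Space) (w : Config N) :
    ∫ X in cellN N L, conj (fderiv ℝ a (X + (Pi.single i y : Config N)) w) * b X =
      -∫ X in cellN N L, conj (a (X + (Pi.single i y : Config N))) * fderiv ℝ b X w := by
  set F : Config N → ℂ := fun X => conj (a (X + (Pi.single i y : Config N))) with hFdef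
  have hta : ContDiff ℝ 1 fun X : Config N => a (X + (Pi.single i y : Config N)) :=
    ha.comp (contDiff_id.add contDiff_const)
  have hF : ContDiff ℝ 1 F := Complex.conjCLE.contDiff.comp hta
  have hFper : ∀ (X : Config N) (j : Fin N) (c : Fin 3),
      F (X + Pi.single j (EuclideanSpace.single c L)) = F X := by
    intro X j c
    simp only [hFdef]
    rw [add_right_comm, haper]
  have hFd : ∀ X, fderiv ℝ F X w = conj (fderiv ℝ a (X + (Pi.single i y : Config N)) w) := by
    intro X
    simp only [hFdef]
    rw [fderiv_conj_apply ((hta.differentiable one_ne_zero) X)]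
    congr 1
    rw [show (fun X : Config N => a (X + (Pi.single i y : Config N))) =
      fun X => a (X + (Pi.single i y : Config N)) from rfl, fderiv_comp_add_right]
  have h := integral_cellN_mul_fderiv_apply hL hF hb hFper hbper w
  simp only [hFd] at h
  rw [h, neg_neg]

end HarmonicMinorant

end Summit.AtomisticToContinuum.BoseEinsteinCondensation.Theorems
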